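import Mathlib.CategoryTheory.Galois.Examples
import Mathlib.CategoryTheory.Limits.FullSubcategory
import Mathlib.CategoryTheory.Action.Limits
import Literature.AnabelianGeometry.Anabelioids.BasicProofs
import Literature.AnabelianGeometry.SemiGraphs.Commensurability

/-!
# Semi-graphs of profinite groups as semi-graphs of anabelioids ([SemiAnbd] §2 pp. 22–23, 27–29)

Mochizuki, *Semi-graphs of anabelioids*, Publ. RIMS **42** (2006) 221–322, §2
[cite: MochizukiSemiAnbd2006, Def. 2.1 pp.22-23]: Definition 2.1 refers to "the notion of a
semi-graph of profinite groups introduced in [Mzk3], Appendix", and p. 23 notes that "if we choose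
basepoints for the constituent anabelioids of `𝒢`, then `𝒢` determines a semi-graph of profinite
groups".  Conversely a *semi-graph of (topological) groups* — groups `G_v`, `G_e` and a continuous
homomorphism `G_e → G_v` for every branch of `e` abutting to `v` — determines a semi-graph of
anabelioids with constituents `B(G_v)`, `B(G_e)` (the tree's `BCat`, a Galois category for every
topological group by `Anabelioids.galoisCategory_bCat`, L3-t5) and `b_* = B(G_e → G_v)`, whose
pull-back functor is restriction of the action (`ContAction.res`).  This file:

* proves that restriction `ContAction.res FintypeCat f` along a continuous homomorphism is EXACT
  (continuity of finite `G`-sets is closed under finite limits and colimits —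
  `Anabelioids/BasicProofs.lean`, L3-t5 — so limits and colimits in `B(G)` are computed in
  `Action FintypeCat G`, where restriction preserves them);
* constructs `SemiGraphOfGroups.toAnabelioids`;
* types the two concrete graphs of anabelioids of Remark 2.5.1 (one vertex, one loop, `B(G^ℕ)`,
  branches `id` and `B(α)`) and Remark 2.6.1 (vertices `1, 2, 3`, `B(G)`, `B(H)`, `B(H)` for an open
  `H ⊆ G`, edges `B(H)`) together with their printed claims as NAMED FACTS over the real objects — for Remark 2.5.1
  in the corrected reading "the image of `Π_v` in `Π_𝒢` is trivial" (`Π_𝒢` itself is `Ẑ`; see the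
  docstring of `remark_2_5_1_trivialImage`), for Remark 2.6.1 "`Π_𝒢` is naturally isomorphic to `G`"
  (as bijectivity of `Π_1 → Π_𝒢`) and "the conclusion of Proposition 2.6 is false".
-/

namespace Literature.AnabelianGeometry.SemiGraphs

open CategoryTheory CategoryTheory.Limits CategoryTheory.PreGaloisCategory
open Literature.AlgebraicGeometry.Frobenioids (BCat)
open Literature.AnabelianGeometry.Anabelioids
open scoped FintypeCatDiscrete Pointwise

universe u

/-! ### Restriction along a continuous homomorphism is exact -/

section ResExact

variable {G H : Type u} [Group G] [TopologicalSpace G]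
  [Group H] [TopologicalSpace H] [IsTopologicalGroup H]

/-- Restriction of finite continuous actions along a continuous homomorphism `f : G → H` preserves
finite limits: `B(f) : B(H) → B(G)` is left exact ([GeoAn] Def. 1.1.2 (i): morphisms of connected
anabelioids are exact functors). [cite: MochizukiGeoAn2004, Def. 1.1.2(i) p.10] -/
theorem preservesFiniteLimits_res (f : G →ₜ* H) :
    PreservesFiniteLimits (ContAction.res FintypeCat.{u} f) := by
  constructor
  intro J _ _
  haveI := isClosedUnderLimitsOfShape_isContinuous (G := H) J
  haveI : PreservesLimitsOfShape J (Action.res FintypeCat.{u} (f : G →* H)) :=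
    Action.preservesLimitsOfShape_of_preserves _
      (inferInstanceAs (PreservesLimitsOfShape J (Action.forget FintypeCat.{u} H)))
  haveI : PreservesLimitsOfShape J (ContAction.res FintypeCat.{u} f ⋙
      ObjectProperty.ι (Action.IsContinuous (V := FintypeCat.{u}) (G := G))) :=
    inferInstanceAs (PreservesLimitsOfShape J
      (ObjectProperty.ι (Action.IsContinuous (V := FintypeCat.{u}) (G := H)) ⋙
        Action.res FintypeCat.{u} (f : G →* H)))
  exact preservesLimitsOfShape_of_reflects_of_preserves (ContAction.res FintypeCat.{u} f)
    (ObjectProperty.ι (Action.IsContinuous (V := FintypeCat.{u}) (G := G)))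

/-- Restriction of finite continuous actions along a continuous homomorphism `f : G → H` preserves
finite colimits: `B(f) : B(H) → B(G)` is right exact.
[cite: MochizukiGeoAn2004, Def. 1.1.2(i) p.10] -/
theorem preservesFiniteColimits_res (f : G →ₜ* H) :
    PreservesFiniteColimits (ContAction.res FintypeCat.{u} f) := by
  constructor
  intro J _ _
  haveI := isClosedUnderColimitsOfShape_isContinuous (G := H) J
  haveI : PreservesColimitsOfShape J (Action.res FintypeCat.{u} (f : G →* H)) :=
    Action.preservesColimitsOfShape_of_preserves _
      (inferInstanceAs (PreservesColimitsOfShape J (Action.forget FintypeCat.{u} H)))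
  haveI : PreservesColimitsOfShape J (ContAction.res FintypeCat.{u} f ⋙
      ObjectProperty.ι (Action.IsContinuous (V := FintypeCat.{u}) (G := G))) :=
    inferInstanceAs (PreservesColimitsOfShape J
      (ObjectProperty.ι (Action.IsContinuous (V := FintypeCat.{u}) (G := H)) ⋙
        Action.res FintypeCat.{u} (f : G →* H)))
  exact preservesColimitsOfShape_of_reflects_of_preserves (ContAction.res FintypeCat.{u} f)
    (ObjectProperty.ι (Action.IsContinuous (V := FintypeCat.{u}) (G := G)))

/-- `B(f) : B(G) → B(H)`, the morphism of connected anabelioids (exact functor `B(H) ⥤ B(G)`,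
restriction of the action) induced by a continuous homomorphism `f : G → H` ([GeoAn] Prop. 1.1.4:
"composition with `ψ` induces a continuous action of `G` on any finite set with continuous
`H`-action"). [cite: MochizukiGeoAn2004, Prop. 1.1.4 p.11] -/
noncomputable def bCatMap (f : G →ₜ* H) : Anabelioids.Hom (BCat G) (BCat H) :=
  haveI := preservesFiniteLimits_res f
  haveI := preservesFiniteColimits_res f
  ExactFunctor.of (ContAction.res FintypeCat.{u} f)

end ResExact

/-! ### Semi-graphs of (topological) groups and their semi-graphs of anabelioids -/

/-- A *semi-graph of (topological, e.g. profinite) groups* over the semi-graph `Γ` ([SemiAnbd] p. 22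
"cf. the notion of a semi-graph of profinite groups introduced in [Mzk3], Appendix"; p. 23): groups
`G_v`, `G_e` and, for each branch `b` of `e` abutting to `v`, a continuous homomorphism `G_e → G_v`.
[cite: MochizukiSemiAnbd2006, Def. 2.1 p.23] -/
structure SemiGraphOfGroups (Γ : SemiGraph.{u}) : Type (u + 1) where
  /-- the vertex groups -/
  GV : Γ.Vertex → Type u
  /-- group structure -/
  [grpV : ∀ v, Group (GV v)]
  /-- topology -/
  [topV : ∀ v, TopologicalSpace (GV v)]
  /-- topological group -/
  [tgV : ∀ v, IsTopologicalGroup (GV v)]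
  /-- the edge groups -/
  GE : Γ.Edge → Type u
  /-- group structure -/
  [grpE : ∀ e, Group (GE e)]
  /-- topology -/
  [topE : ∀ e, TopologicalSpace (GE e)]
  /-- topological group -/
  [tgE : ∀ e, IsTopologicalGroup (GE e)]
  /-- the homomorphism `G_e → G_v` of a branch `b ∈ e` abutting to `v` -/
  hom : ∀ (b : Γ.Branch) (v : Γ.Vertex), Γ.abuts b = some v → GE (Γ.edgeOf b) →ₜ* GV v

attribute [instance] SemiGraphOfGroups.grpV SemiGraphOfGroups.topV SemiGraphOfGroups.tgV
  SemiGraphOfGroups.grpE SemiGraphOfGroups.topE SemiGraphOfGroups.tgE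

namespace SemiGraphOfGroups

variable {Γ : SemiGraph.{u}} (𝔊 : SemiGraphOfGroups Γ)

/-- The semi-graph of anabelioids `{B(G_v), B(G_e), B(G_e → G_v)}` of a semi-graph of topological
groups ([SemiAnbd] p. 23; constituents are connected anabelioids by
`Anabelioids.galoisCategory_bCat`). [cite: MochizukiSemiAnbd2006, Def. 2.1 p.23] -/
noncomputable def toAnabelioids : SemiGraphOfAnabelioids.{u, u + 1, u} :=
  { graph := Γ
    V := fun v => BCat (𝔊.GV v)
    galV := fun v => galoisCategory_bCat (𝔊.GV v)
    E := fun e => BCat (𝔊.GE e)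
    galE := fun e => galoisCategory_bCat (𝔊.GE e)
    pull := fun b v h => bCatMap (𝔊.hom b v h) }

end SemiGraphOfGroups

/-! ### Remark 2.5.1: the graph of anabelioids with trivial `Π_𝒢` (pp. 27–28) -/

section Remark251

/-- The semi-graph of Remark 2.5.1: "the graph with precisely one vertex and one edge [both of whose
branches abut to the unique vertex]". [cite: MochizukiSemiAnbd2006, Rem. 2.5.1 p.28] -/
abbrev loopGraph : SemiGraph.{0} where
  Vertex := PUnit
  Edge := PUnit
  Branch := Bool
  edgeOf _ := PUnit.unit
  abuts _ := some PUnit.unit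
  two_branches _ := ⟨false, true, Bool.false_ne_true, rfl, rfl, fun b _ => by cases b <;> simp⟩

/-- The shift `α : G^ℕ ↪ G^ℕ` of Remark 2.5.1 as a continuous homomorphism (product topology).
[cite: MochizukiSemiAnbd2006, Rem. 2.5.1 p.27] -/
def shiftContinuousHom (G : Type) [Group G] [TopologicalSpace G] : (ℕ → G) →ₜ* (ℕ → G) where
  toMonoidHom := shiftHom G
  continuous_toFun := by
    apply continuous_pi
    intro n
    cases n with
    | zero => exact continuous_const
    | succ m => exact continuous_apply m

/-- The graph of (profinite) groups of Remark 2.5.1: vertex and edge group `G^ℕ` (`G = ℤ/lℤ`), "the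
morphisms `B(G^ℕ) → B(G^ℕ)` corresponding to the two branches of the unique edge are given by the
identity and `B(α)`". [cite: MochizukiSemiAnbd2006, Rem. 2.5.1 p.28] -/
def remark251Groups (l : ℕ) : SemiGraphOfGroups loopGraph where
  GV _ := ℕ → Multiplicative (ZMod l)
  GE _ := ℕ → Multiplicative (ZMod l)
  hom b _ _ := match b with
    | true => ContinuousMonoidHom.id _
    | false => shiftContinuousHom (Multiplicative (ZMod l))

/-- NAMED FACT, [SemiAnbd] Remark 2.5.1, second assertion, in the form its argument yields (as the
gate review of this file established): the printed "one concludes from the above observation that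
the profinite fundamental group associated to this graph of anabelioids `𝒢` is trivial" must be
read as "the image of `Π_v = G^ℕ` in `Π_𝒢` is trivial" (which is what the Remark uses: injectivity
of `Π_v → Π_𝒢` fails without quasi-coherence) — `Π_𝒢` itself is `Ẑ`, generated by the stable
letter of the loop, since `G^ℕ` acts trivially on every object of `B(𝒢)` by `remark_2_5_1` applied
to the powers of `α`.  Stated for every basepoint through the vertex.
[cite: MochizukiSemiAnbd2006, Rem. 2.5.1 p.28] -/
def remark_2_5_1_trivialImage : Prop :=
  ∀ (l : ℕ) [Fact l.Prime]
    (F : (remark251Groups l).toAnabelioids.V PUnit.unit ⥤ FintypeCat.{0}) [FiberFunctor F]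
    (x : (remark251Groups l).toAnabelioids.PiV PUnit.unit F),
    (remark251Groups l).toAnabelioids.piVToPi PUnit.unit F x = 1

end Remark251

/-! ### Remark 2.6.1: the hypotheses of Proposition 2.6 are not superfluous (p. 29) -/

section Remark261

/-- The graph of Remark 2.6.1: "precisely three vertices, labeled 1, 2, 3, and precisely two edges,
one of which joins the vertices 1, 2, the other of which joins the vertices 2, 3" (vertices `Fin 3`,
edges `Fin 2`, the edge `j` joining `j` and `j + 1`). [cite: MochizukiSemiAnbd2006, Rem. 2.6.1 p.29] -/
abbrev pathGraph3 : SemiGraph.{0} where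
  Vertex := Fin 3
  Edge := Fin 2
  Branch := Fin 2 × Bool
  edgeOf b := b.1
  abuts b := some (if b.2 then b.1.succ else b.1.castSucc)
  two_branches e := ⟨(e, false), (e, true), by simp, rfl, rfl, fun b hb => by
    rcases b with ⟨e', c⟩; cases hb; cases c <;> simp⟩

variable {G : Type} [Group G] [TopologicalSpace G] [IsTopologicalGroup G] (H : Subgroup G)

/-- The vertex groups of Remark 2.6.1 as subgroups of `G`: `G (= ⊤)` at the vertex `1`, `H` at the
vertices `2`, `3` ("equipping the vertex 1 (respectively, 2; 3) with the anabelioid `B(G)`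
(respectively, `B(H)`; `B(H)`)"; `B(⊤) ≅ B(G)`). [cite: MochizukiSemiAnbd2006, Rem. 2.6.1 p.29] -/
def remark261VertexSubgroup : Fin 3 → Subgroup G
  | 0 => ⊤
  | _ => H

omit [TopologicalSpace G] [IsTopologicalGroup G] in
/-- `H` lies in every vertex subgroup of Remark 2.6.1 (the branch homomorphisms are "induced by
the identity and inclusion homomorphisms"). [cite: MochizukiSemiAnbd2006, Rem. 2.6.1 p.29] -/
theorem le_remark261VertexSubgroup (i : Fin 3) : H ≤ remark261VertexSubgroup H i := by
  match i with
  | 0 => exact le_top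
  | 1 => exact le_rfl
  | 2 => exact le_rfl

/-- The graph of (profinite) groups of Remark 2.6.1: vertex groups `G, H, H`, edge groups `H`, all
branch homomorphisms the identity / the inclusion `H ↪ G`.
[cite: MochizukiSemiAnbd2006, Rem. 2.6.1 p.29] -/
def remark261Groups : SemiGraphOfGroups pathGraph3 where
  GV i := remark261VertexSubgroup H i
  GE _ := H
  hom _ v _ :=
    { toMonoidHom := Subgroup.inclusion (le_remark261VertexSubgroup H v)
      continuous_toFun := continuous_inclusion (le_remark261VertexSubgroup H v) }

/-- The subgraph `ℍ` "determined by the [non-elevated!] vertex 1" (Remark 2.6.1).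
[cite: MochizukiSemiAnbd2006, Rem. 2.6.1 p.29] -/
def remark261H : pathGraph3.Subgraph := ⟨{(0 : Fin 3)}, ∅⟩

/-- The subgraph `𝕂` "determined by the vertices 2, 3 and the [non-sub-coverticial!] edge that joins
them" (Remark 2.6.1). [cite: MochizukiSemiAnbd2006, Rem. 2.6.1 p.29] -/
def remark261K : pathGraph3.Subgraph := ⟨{(1 : Fin 3), 2}, {(1 : Fin 2)}⟩

/-- The conclusion of Proposition 2.6 for subgraphs `ℍ`, `𝕂` of a semi-graph of anabelioids, with
`Π_ℍ`, `Π_𝕂` mapped into `Π_𝒢` through vertices `w ∈ ℍ`, `w' ∈ 𝕂` and a transport `α` of basepoints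
(the predicate negated in Remark 2.6.1). [cite: MochizukiSemiAnbd2006, Prop. 2.6 p.28] -/
def Prop26Conclusion (𝒢 : SemiGraphOfAnabelioids.{0, 1, 0}) (A B : 𝒢.graph.Subgraph)
    (w : A.toSemiGraph.Vertex) (F : 𝒢.V w.1 ⥤ FintypeCat.{0})
    (w' : B.toSemiGraph.Vertex) (F' : 𝒢.V w'.1 ⥤ FintypeCat.{0})
    (α : 𝒢.ρ w'.1 ⋙ F' ≅ 𝒢.ρ w.1 ⋙ F) : Prop :=
  let PA := (𝒢.piHToPi A w F).range
  let PB := ((Aut.autMulEquivOfIso α).toMonoidHom.comp (𝒢.piHToPi B w' F')).range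
  (∀ g : 𝒢.Pi w.1 F, (ConjAct.toConjAct g • PB).relIndex PA = 0) ∧
    ∀ g g' : 𝒢.Pi w.1 F, ¬ Subgroup.Commensurable (ConjAct.toConjAct g • PA) (ConjAct.toConjAct g' • PB)

/-- NAMED FACT, [SemiAnbd] Remark 2.6.1: for a profinite group `G` and an open subgroup `H ⊆ G`, the
graph of anabelioids `𝒢` above has "profinite fundamental group … naturally isomorphic to `G`" (rendered
sharply: `Π_1 = π₁(B(⊤), β) → Π_𝒢` is bijective, `B(⊤) ≅ B(G)`), and for
`ℍ` (the vertex 1) and `𝕂` (vertices 2, 3 and their edge) "the conclusion of Proposition 2.6 is false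
[even if one interchanges `ℍ`, `𝕂`]" — for all basepoints and transports.
[cite: MochizukiSemiAnbd2006, Rem. 2.6.1 p.29] -/
def remark_2_6_1 : Prop :=
  ∀ (G : Type) [Group G] [TopologicalSpace G] [IsTopologicalGroup G] [CompactSpace G] [T2Space G]
    [TotallyDisconnectedSpace G] (H : Subgroup G), IsOpen (H : Set G) →
    let 𝒢 := (remark261Groups H).toAnabelioids
    (∀ (F : 𝒢.V (0 : Fin 3) ⥤ FintypeCat.{0}) [FiberFunctor F],
        Function.Bijective (𝒢.piVToPi (0 : Fin 3) F)) ∧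
    (∀ (F : 𝒢.V (0 : Fin 3) ⥤ FintypeCat.{0}) [FiberFunctor F]
        (F' : 𝒢.V (1 : Fin 3) ⥤ FintypeCat.{0}) [FiberFunctor F']
        (α : 𝒢.ρ (1 : Fin 3) ⋙ F' ≅ 𝒢.ρ (0 : Fin 3) ⋙ F)
        (β : 𝒢.ρ (0 : Fin 3) ⋙ F ≅ 𝒢.ρ (1 : Fin 3) ⋙ F'),
        ¬ Prop26Conclusion 𝒢 remark261H remark261K ⟨(0 : Fin 3), rfl⟩ F
            ⟨(1 : Fin 3), Or.inl rfl⟩ F' α ∧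
        ¬ Prop26Conclusion 𝒢 remark261K remark261H ⟨(1 : Fin 3), Or.inl rfl⟩ F'
            ⟨(0 : Fin 3), rfl⟩ F β)

end Remark261

end Literature.AnabelianGeometry.SemiGraphs
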